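import Mathlib.Geometry.Manifold.SmoothEmbedding
import Mathlib.Geometry.Manifold.ContMDiff.Atlas
import HarnessLib

/-!
# Precomposing immersions and smooth embeddings with a partial diffeomorphism

Topic `Literature/Topology/FourManifolds` (general differential topology helper, Mathlib-level).
Mathlib records composition of immersions / smooth embeddings as future work
(`Mathlib/Geometry/Manifold/Immersion.lean`, TODO `IsImmersionAt.comp`;
`Mathlib/Geometry/Manifold/SmoothEmbedding.lean`, `proof_wanted IsSmoothEmbedding.comp`). This
file proves the special case that is needed repeatedly in the four-manifold files of the tree:
**precomposition with a partial diffeomorphism** — an open partial homeomorphism `Φ : M' ⇀ M`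
(same model on `M'` and `M`) which is `C^n` on its source with `C^n` inverse on its target:

* `Manifold.IsImmersionAtOfComplement.comp_openPartialHomeomorph` — `f` an immersion at `Φ x`,
  `x ∈ Φ.source` ⇒ `f ∘ Φ` an immersion at `x` (transport the domain chart along `Φ`, keep the
  codomain chart and the linear normal form);
* `Manifold.IsImmersionOfComplement.comp_openPartialHomeomorph`,
  `Manifold.IsImmersion.comp_openPartialHomeomorph`,
  `Manifold.IsSmoothEmbedding.comp_openPartialHomeomorph` — the global versions for `Φ` with
  `Φ.source = univ` (e.g. Mathlib's `OpenPartialHomeomorph.univBall c r : E ≅ B_r(c)`, used to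
  restrict a tubular-neighbourhood map to a thinner tube reparametrised over the whole fibre);
* `OpenPartialHomeomorph.range_comp_eq_image_target` — `range (g ∘ Φ) = g '' Φ.target`.

Standard differential topology: J. M. Lee, *Introduction to Smooth Manifolds*, 2nd ed. (2013),
Ch. 4 (compositions of immersions), Ch. 5 (embeddings). [folklore]

## Design notes

* These are deliberate dot-notation extensions in Mathlib's `Manifold` namespace.
* refactor: the tree's `Manifold.IsImmersionAtOfComplement.comp_diffeomorph`,
  `IsImmersionOfComplement.comp_diffeomorph`, `IsImmersion.comp_diffeomorph`,
  `IsSmoothEmbedding.comp_diffeomorph` (`CerfGammaFourProofs.lean`, the case of a diffeomorphism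
  `Φ`) are one-line specialisations of the lemmas below via
  `Φ.toHomeomorph.toOpenPartialHomeomorph` and `Φ.contMDiff.contMDiffOn`; they are not restated
  here to avoid duplicate names, and can be re-derived from this file by the librarian.
* No declaration in this file uses `sorry`.
-/

open scoped Manifold ContDiff Topology
open Function Set

noncomputable section

/-! ### Precomposing immersions and smooth embeddings with a partial diffeomorphism -/

namespace Manifold

universe u

variable {E : Type*} {E' : Type u} {F : Type*} [NormedAddCommGroup E] [NormedSpace ℝ E]
  [NormedAddCommGroup E'] [NormedSpace ℝ E'] [NormedAddCommGroup F] [NormedSpace ℝ F]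
  {H : Type*} [TopologicalSpace H] {G : Type*} [TopologicalSpace G]
  {I : ModelWithCorners ℝ E H} {J : ModelWithCorners ℝ E' G}
  {M : Type*} [TopologicalSpace M] [ChartedSpace H M]
  {M' : Type*} [TopologicalSpace M'] [ChartedSpace H M']
  {N : Type*} [TopologicalSpace N] [ChartedSpace G N]
  {n : ℕ∞ω} {f : M → N}

/-- **Precomposition of an immersion (chosen complement) with a partial diffeomorphism.** If
`Φ : M' ⇀ M` is an open partial homeomorphism which is `C^n` on its source with `C^n` inverse on
its target (same model `I` on `M'` and `M`), `x ∈ Φ.source`, and `f` is an immersion at `Φ x`,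
then `f ∘ Φ` is an immersion at `x`: transport the domain chart along `Φ` (`Φ ≫ domChart` is in
the maximal atlas of `M'`), keep the codomain chart and the linear normal form. The version for
a diffeomorphism `Φ` is the tree's `IsImmersionAtOfComplement.comp_diffeomorph`.
Lee, *Introduction to Smooth Manifolds* (2013), Ch. 4. [folklore] -/
theorem IsImmersionAtOfComplement.comp_openPartialHomeomorph [IsManifold I n M]
    [IsManifold I n M'] (Φ : OpenPartialHomeomorph M' M) (hΦ : ContMDiffOn I I n Φ Φ.source)
    (hΦ' : ContMDiffOn I I n Φ.symm Φ.target) {x : M'} (hx : x ∈ Φ.source)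
    (h : IsImmersionAtOfComplement F I J n f (Φ x)) :
    IsImmersionAtOfComplement F I J n (f ∘ Φ) x := by
  set c : OpenPartialHomeomorph M' H := Φ ≫ₕ h.domChart with hc
  have hcatlas : c ∈ IsManifold.maximalAtlas I n M' := by
    rw [IsManifold.mem_maximalAtlas_iff_contMDiffOn]
    constructor
    · have h1 := contMDiffOn_of_mem_maximalAtlas h.domChart_mem_maximalAtlas
      have : ContMDiffOn I I n (h.domChart ∘ Φ) c.source := by
        refine h1.comp (hΦ.mono ?_) ?_
        · intro y hy
          simp only [hc, OpenPartialHomeomorph.trans_source, mem_inter_iff, mem_preimage] at hy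
          exact hy.1
        · intro y hy
          simp only [hc, OpenPartialHomeomorph.trans_source, mem_inter_iff, mem_preimage] at hy
          exact hy.2
      exact this.congr fun y _ => by simp [hc]
    · have h1 := contMDiffOn_symm_of_mem_maximalAtlas h.domChart_mem_maximalAtlas
      have : ContMDiffOn I I n (Φ.symm ∘ h.domChart.symm) c.target := by
        refine hΦ'.comp (h1.mono ?_) ?_
        · intro y hy
          simp only [hc, OpenPartialHomeomorph.trans_target, mem_inter_iff, mem_preimage] at hy
          exact hy.1
        · intro y hy
          simp only [hc, OpenPartialHomeomorph.trans_target, mem_inter_iff, mem_preimage] at hy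
          exact hy.2
      exact this.congr fun y _ => by simp [hc]
  refine IsImmersionAtOfComplement.mk_of_charts h.equiv c h.codChart ?_ h.mem_codChart_source
    hcatlas h.codChart_mem_maximalAtlas ?_ ?_
  · simp only [hc, OpenPartialHomeomorph.trans_source, mem_inter_iff, mem_preimage]
    exact ⟨hx, h.mem_domChart_source⟩
  · intro y hy
    simp only [hc, OpenPartialHomeomorph.trans_source, mem_inter_iff, mem_preimage] at hy
    exact h.source_subset_preimage_source hy.2
  · intro y hy
    simp only [OpenPartialHomeomorph.extend_target, mem_inter_iff, mem_preimage, hc,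
      OpenPartialHomeomorph.trans_target] at hy
    obtain ⟨⟨hy1, hy2⟩, hy3⟩ := hy
    have hy' : y ∈ (h.domChart.extend I).target := by
      rw [OpenPartialHomeomorph.extend_target]
      exact ⟨hy1, hy3⟩
    have := h.writtenInCharts hy'
    simp only [Function.comp_apply, OpenPartialHomeomorph.extend_coe_symm] at this ⊢
    simp only [hc, OpenPartialHomeomorph.coe_trans_symm, Function.comp_apply]
    rw [Φ.right_inv hy2]
    exact this

/-- Precomposition of a global immersion (chosen complement) with a globally defined partial
diffeomorphism (an open partial homeomorphism with source `univ`, `C^n` with `C^n` inverse).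
[folklore] -/
theorem IsImmersionOfComplement.comp_openPartialHomeomorph [IsManifold I n M] [IsManifold I n M']
    (Φ : OpenPartialHomeomorph M' M) (hsrc : Φ.source = univ) (hΦ : ContMDiffOn I I n Φ Φ.source)
    (hΦ' : ContMDiffOn I I n Φ.symm Φ.target) (h : IsImmersionOfComplement F I J n f) :
    IsImmersionOfComplement F I J n (f ∘ Φ) := fun x =>
  (h (Φ x)).comp_openPartialHomeomorph Φ hΦ hΦ' (hsrc ▸ mem_univ x)

omit [NormedAddCommGroup F] [NormedSpace ℝ F] in
/-- An immersion precomposed with a globally defined partial diffeomorphism is an immersion.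
Lee (2013), Ch. 4. [folklore] -/
theorem IsImmersion.comp_openPartialHomeomorph [IsManifold I n M] [IsManifold I n M']
    (Φ : OpenPartialHomeomorph M' M) (hsrc : Φ.source = univ) (hΦ : ContMDiffOn I I n Φ Φ.source)
    (hΦ' : ContMDiffOn I I n Φ.symm Φ.target) (h : IsImmersion I J n f) :
    IsImmersion I J n (f ∘ Φ) := by
  obtain ⟨F, _, _, h⟩ := h
  exact ⟨F, inferInstance, inferInstance, h.comp_openPartialHomeomorph Φ hsrc hΦ hΦ'⟩

omit [NormedAddCommGroup F] [NormedSpace ℝ F] in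
/-- **A smooth embedding precomposed with a globally defined partial diffeomorphism is a smooth
embedding** (e.g. restricting a tubular neighbourhood map to a smaller tube reparametrised over
the whole fibre). Lee (2013), Ch. 4–5. [folklore] -/
theorem IsSmoothEmbedding.comp_openPartialHomeomorph [IsManifold I n M] [IsManifold I n M']
    (Φ : OpenPartialHomeomorph M' M) (hsrc : Φ.source = univ) (hΦ : ContMDiffOn I I n Φ Φ.source)
    (hΦ' : ContMDiffOn I I n Φ.symm Φ.target) (h : IsSmoothEmbedding I J n f) :
    IsSmoothEmbedding I J n (f ∘ Φ) :=
  ⟨h.isImmersion.comp_openPartialHomeomorph Φ hsrc hΦ hΦ',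
    h.isEmbedding.comp (Φ.to_isOpenEmbedding hsrc).isEmbedding⟩

omit [NormedAddCommGroup F] [NormedSpace ℝ F] in
/-- The range of a map precomposed with a globally defined open partial homeomorphism is the
image of its target; if the map is an open embedding this range is open. [folklore] -/
theorem _root_.OpenPartialHomeomorph.range_comp_eq_image_target {α β γ : Type*}
    [TopologicalSpace α] [TopologicalSpace β] (Φ : OpenPartialHomeomorph α β)
    (hsrc : Φ.source = univ) (g : β → γ) : range (g ∘ Φ) = g '' Φ.target := by
  rw [range_comp, ← Φ.image_source_eq_target, hsrc, image_univ]

end Manifold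

end
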